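import Summits.BirchSwinnertonDyer.Rank1Residual.AdditivePotMult.Twist
import Summits.BirchSwinnertonDyer.Rank1Residual.X11b.TwistTransport
import Literature.NumberTheory.QuadraticForms.PadicHilbertSymbol
import HarnessLib

/-!
# X3♯(M): a `p`-multiplicative Greenberg–Vatsal twist ALWAYS exists (gvpar is never the obstruction)

HONEST FRAMING (cell `b2b-bsdres`, run/shared/lean/b2b/bsd-rank1-residual/, verbatim in every
file): the goal of the cell is to DELETE the COMBINATION-SHAPED residual classes of the
Birch–Swinnerton-Dyer formula for ALL analytic-rank `≤ 1` elliptic curves over `ℚ` — "full BSD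
formula for every rank `≤ 1` curve in class `C`" assembled STRICTLY from published theorems — so
that the rank-`≤ 1` remainder becomes exactly the CONSTRUCTION-SHAPED classes, which are TYPED
(missing-input `Prop`s), NOT attempted. This is not "finishing BSD". Sub-cell
`b2b-bsdres-additive-p1` (CLASS-OWNERS row "X3/X4 additive — pot. multiplicative / X3♯(M)"),
generation 2; research route, no claim beyond the stated sub-classes; X3♯(M) REMAINS
CONSTRUCTION-SHAPED.

Theorems only. `GreenbergVatsalTwist.lean` / `ModelFreeClassTheorems.lean` convert an X3♯(M) pair
to the over-`K` input ALONE as soon as the `p`-multiplicative twist `E^{(D)}` has `L(E^{(D)},1) ≠ 0`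
AND the Greenberg–Vatsal parity condition gvpar. This file proves, sorry-free, that the gvpar half
of that datum is NEVER an obstruction:

* `gvPar_of_smul_eq` — **gvpar is a property of the curve, not of the model**: if `C • Wd = W`
  then `GVPar W p → GVPar Wd p` (transport of rational lines along the model isomorphism on
  `ℚ̄`-points, `VariableChange.pointEquivBaseChange`, which is `Γ_ℚ`-equivariant; parity and
  (un)ramifiedness at `p` are preserved). The bookkeeping of the X1 file
  `Rank1Residual/GVParityTwistProofs` in the sign-free case.
* `mult_quadraticTwist_mul_of_padicSquare` — twisting further by a `p`-adic square keeps
  multiplicative reduction at `p` (x11b's `hasMultiplicativeReductionAtPrime_quadraticTwist_iff`).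
* **`ClassX3M.exists_mult_gvPar_twist`** — for `(E,p) ∈ X3♯(M)` there is `d ∈ ℚ^×` such that EVERY
  model of `E^{(d)}` is multiplicative at `p` and satisfies gvpar. Proof: a `p`-multiplicative twist
  `E^{(d₀)}` exists (`PotMult.exists_twist_mult`, Silverman *ATAEC* V.5.3); if it fails gvpar, twist
  once more by `n = 1 − p²`: `n < 0`, `p ∤ n`, and `n ≡ 1 (mod p)` is a `p`-adic square (Hensel,
  tree `padic_isSquare_intCast_of_isSquare_zmod`), so `E^{(d₀ n)}` is still multiplicative at `p` and,
  by the tree's PROVED twist law `gvPar_of_not_gvPar_of_twist` (odd twist unramified at `p` swaps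
  the two Greenberg–Vatsal types), satisfies gvpar.

So on X3♯(M) the per-pair datum of the route reduces to the ANALYTIC one — a fundamental `D` in the
gvpar sign class of `p`-multiplicative twists with `L(E^{(D)},1) ≠ 0` (Friedberg–Hoffstein /
Waldspurger territory; census HOME/b2b-bsdres-additive-p1/REPORT.md §6.4: found for all 517 ‖ 298
pairs `N < 2·10⁴`). Nothing here moves a label.
-/

set_option autoImplicit false

noncomputable section

open scoped Classical

open WeierstrassCurve Literature.NumberTheory.EllipticCurves
  Literature.NumberTheory.EllipticCurves.Rank1Residual
  Literature.NumberTheory.GaloisRepresentations Field IsDedekindDomain NumberField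

namespace Summit.BirchSwinnertonDyer.Rank1Residual.AdditivePotMult

variable {W : WeierstrassCurve ℚ} [W.IsElliptic] {p : ℕ} [Fact p.Prime]

/-! ### gvpar is model-independent -/

omit [W.IsElliptic] in
/-- **gvpar does not depend on the Weierstrass model.** If `C • Wd = W` then a rational line
`Φ ≤ W[p]` of Greenberg–Vatsal type pulls back, along the `Γ_ℚ`-EQUIVARIANT isomorphism of
`ℚ̄`-points `Wd(ℚ̄) ≃ (C • Wd)(ℚ̄) = W(ℚ̄)` (`VariableChange.pointEquivBaseChange`), to a rational line
of `Wd[p]` of the same parity and the same ramification at `p`. (Same transport as the tree's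
`gvPar_of_not_gvPar_of_twist`, without the sign.) [folklore] -/
theorem gvPar_of_smul_eq (Wd : WeierstrassCurve ℚ) [Wd.IsElliptic] (C : VariableChange ℚ)
    (hC : C • Wd = W) (h : GVPar W p) : GVPar Wd p := by
  -- the model isomorphism on geometric points, `Γ_ℚ`-equivariant
  let e₁ : Wd.geomPoints ≃+ (C • Wd).geomPoints :=
    VariableChange.pointEquivBaseChange Wd C (AlgebraicClosure ℚ)
  let e₂ : (C • Wd).geomPoints ≃+ W.geomPoints :=
    Affine.Point.congrEquiv (congrArg (fun Z : WeierstrassCurve ℚ ↦ Z.baseChange (AlgebraicClosure ℚ)) hC)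
  have h₁ : ∀ (σ : absoluteGaloisGroup ℚ) (P : Wd.geomPoints), e₁ (σ • P) = σ • e₁ P := fun σ P ↦
    VariableChange.pointEquivBaseChange_map_algEquiv Wd C (absoluteGaloisGroup.toAlgEquiv ℚ σ) P
  have h₂ : ∀ (σ : absoluteGaloisGroup ℚ) (P : (C • Wd).geomPoints), e₂ (σ • P) = σ • e₂ P :=
    fun σ P ↦ congrEquiv_smul_of_eq hC (absoluteGaloisGroup.toAlgEquiv ℚ σ) P
  set F : Wd.geomPoints ≃+ W.geomPoints := e₁.trans e₂ with hF
  have hFeq : ∀ (σ : absoluteGaloisGroup ℚ) (P : Wd.geomPoints), F (σ • P) = σ • F P := by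
    intro σ P
    simp only [hF, AddEquiv.trans_apply]
    rw [h₁, h₂]
  -- `F` on `p`-torsion
  have hmem : ∀ T : geomTorsion Wd (p : ℤ), F T ∈ geomTorsion W (p : ℤ) := by
    intro T
    rw [AddSubgroup.torsionBy.nsmul_iff, ← map_nsmul, AddSubgroup.torsionBy.nsmul_iff.mp T.2,
      map_zero]
  let φ : geomTorsion Wd (p : ℤ) →+ geomTorsion W (p : ℤ) :=
    AddMonoidHom.codRestrict ((F : Wd.geomPoints →+ W.geomPoints).comp
      (geomTorsion Wd (p : ℤ)).subtype) (geomTorsion W (p : ℤ)) hmem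
  have hφ : ∀ T, ((φ T : geomTorsion W (p : ℤ)) : W.geomPoints) = F T := fun T ↦ rfl
  have hφinj : Function.Injective φ := by
    intro T₁ T₂ h12
    have h' := congrArg (fun S : geomTorsion W (p : ℤ) ↦ (S : W.geomPoints)) h12
    simp only [hφ] at h'
    exact Subtype.ext (F.injective h')
  have hφsurj : Function.Surjective φ := by
    intro S
    have hS : F.symm S ∈ geomTorsion Wd (p : ℤ) := by
      rw [AddSubgroup.torsionBy.nsmul_iff]
      apply F.injective
      rw [map_nsmul, AddEquiv.apply_symm_apply, map_zero]
      exact AddSubgroup.torsionBy.nsmul_iff.mp S.2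
    refine ⟨⟨F.symm S, hS⟩, Subtype.ext ?_⟩
    rw [hφ]
    exact F.apply_symm_apply S
  let eφ : geomTorsion Wd (p : ℤ) ≃+ geomTorsion W (p : ℤ) := AddEquiv.ofBijective φ ⟨hφinj, hφsurj⟩
  have heφ : ∀ T, eφ T = φ T := fun T ↦ rfl
  have hφeq : ∀ (σ : absoluteGaloisGroup ℚ) (T : geomTorsion Wd (p : ℤ)), φ (σ • T) = σ • φ T :=
    fun σ T ↦ Subtype.ext (by rw [AddSubgroup.torsionBy.coe_smul, hφ, hφ,
      AddSubgroup.torsionBy.coe_smul, hFeq σ])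
  -- the line `Φ ≤ W[p]` of Greenberg–Vatsal type and its transport `Φ' ≤ Wd[p]`
  obtain ⟨Φ, hΦ, htype⟩ := h
  let Φ' : AddSubgroup (geomTorsion Wd (p : ℤ)) := Φ.map eφ.symm.toAddMonoidHom
  have hmemΦ' : ∀ T, T ∈ Φ' ↔ φ T ∈ Φ := by
    intro T
    rw [AddSubgroup.mem_map_equiv, AddEquiv.symm_symm, heφ]
  have hcardΦ' : Nat.card Φ' = p :=
    (Nat.card_congr (Φ.equivMapOfInjective eφ.symm.toAddMonoidHom eφ.symm.injective).toEquiv).symm.trans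
      hΦ.1
  have hstabΦ' : ∀ (σ : absoluteGaloisGroup ℚ), ∀ T ∈ Φ', σ • T ∈ Φ' := by
    intro σ T hT
    rw [hmemΦ'] at hT ⊢
    rw [hφeq σ]
    exact hΦ.2 σ _ hT
  have hΦ' : IsRationalLine Wd p Φ' := ⟨hcardΦ', hstabΦ'⟩
  -- parity is preserved
  have heven : LineEven W p Φ → LineEven Wd p Φ' := by
    intro hev c hc T hT
    have hcT := hφeq c T
    rw [hev c hc (φ T) ((hmemΦ' T).mp hT)] at hcT
    exact hφinj hcT
  have hodd : LineOdd W p Φ → LineOdd Wd p Φ' := by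
    intro hod c hc T hT
    have hcT := hφeq c T
    rw [hod c hc (φ T) ((hmemΦ' T).mp hT), ← map_neg] at hcT
    exact hφinj hcT
  -- (un)ramifiedness at `p` is preserved
  have hunr : LineUnramifiedAt W p Φ → LineUnramifiedAt Wd p Φ' := by
    intro hu v hpv 𝔓 h𝔓 σ hσ T hT
    have hσT := hφeq σ T
    rw [hu v hpv 𝔓 h𝔓 σ hσ (φ T) ((hmemΦ' T).mp hT)] at hσT
    exact hφinj hσT
  have hram : ¬ LineUnramifiedAt W p Φ → ¬ LineUnramifiedAt Wd p Φ' := by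
    intro hr h'
    apply hr
    intro v hpv 𝔓 h𝔓 σ hσ S hS
    obtain ⟨T, rfl⟩ := hφsurj S
    have hT : T ∈ Φ' := (hmemΦ' T).mpr hS
    rw [← hφeq σ T, h' v hpv 𝔓 h𝔓 σ hσ T hT]
  rcases htype with ⟨hr, hev⟩ | ⟨hu, hod⟩
  · exact ⟨Φ', hΦ', Or.inl ⟨hram hr, heven hev⟩⟩
  · exact ⟨Φ', hΦ', Or.inr ⟨hunr hu, hodd hod⟩⟩

/-- gvpar passes between any two models of the same curve (both directions of
`gvPar_of_smul_eq`). [folklore] -/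
theorem gvPar_iff_of_smul_eq (Wd : WeierstrassCurve ℚ) [Wd.IsElliptic] (C : VariableChange ℚ)
    (hC : C • Wd = W) : GVPar Wd p ↔ GVPar W p := by
  refine ⟨fun h => ?_, gvPar_of_smul_eq Wd C hC⟩
  haveI : (C • Wd).IsElliptic := by rw [hC]; infer_instance
  have hC' : C⁻¹ • W = Wd := by rw [← hC, inv_smul_smul]
  exact gvPar_of_smul_eq (W := Wd) W C⁻¹ hC' h

/-! ### Twisting by a `p`-adic square keeps multiplicative reduction -/

/-- **A further twist by a `p`-adic square keeps multiplicative reduction at `p`**: if `E^{(d)}` is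
multiplicative at `p` and `n ∈ ℚ^×` is a square in `ℚ_p` then `E^{(d n)} = (E^{(d)})^{(n)}` is
multiplicative at `p` (x11b's `hasMultiplicativeReductionAtPrime_quadraticTwist_iff`: over `ℚ_p` the
two curves are isomorphic; `quadraticTwist_quadraticTwist`). [folklore] -/
theorem mult_quadraticTwist_mul_of_padicSquare {d n : ℚ} (hd : d ≠ 0) (hn : n ≠ 0)
    (hsq : IsSquare (algebraMap ℚ ℚ_[p] n)) (hmult : Mult (W.quadraticTwist d) p) :
    Mult (W.quadraticTwist (d * n)) p := by
  haveI := W.isElliptic_quadraticTwist hd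
  have h := (X11b.hasMultiplicativeReductionAtPrime_quadraticTwist_iff (W.quadraticTwist d)
    (q := p) hn hsq).mpr hmult
  rwa [quadraticTwist_quadraticTwist] at h

/-- `1 − p²` is a square in `ℚ_p` for an odd prime `p` (it is `≡ 1 (mod p)`; Hensel — tree
`padic_isSquare_intCast_of_isSquare_zmod`, Serre, *Cours d'arithmétique* II.3.3). [folklore] -/
theorem isSquare_padic_one_sub_sq (hp2 : p ≠ 2) :
    IsSquare (algebraMap ℚ ℚ_[p] ((1 - (p : ℤ) ^ 2 : ℤ) : ℚ)) := by
  have hnd : ¬ (p : ℤ) ∣ (1 - (p : ℤ) ^ 2) := by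
    intro h
    have h1 : (p : ℤ) ∣ 1 := by
      have : (p : ℤ) ∣ (1 - (p : ℤ) ^ 2) + (p : ℤ) ^ 2 := dvd_add h (dvd_pow_self _ two_ne_zero)
      simpa using this
    exact (Fact.out : p.Prime).ne_one (by exact_mod_cast Int.eq_one_of_dvd_one (Int.natCast_nonneg p) h1)
  have hsq : IsSquare (((1 - (p : ℤ) ^ 2 : ℤ)) : ZMod p) := by
    refine ⟨1, ?_⟩
    push_cast
    rw [ZMod.natCast_self]
    ring
  have h := Literature.NumberTheory.QuadraticForms.padic_isSquare_intCast_of_isSquare_zmod hp2 hnd hsq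
  simpa using h

/-! ### Existence of a `p`-multiplicative Greenberg–Vatsal twist -/

/-- **For `(E,p) ∈ X3♯(M)` a `p`-multiplicative Greenberg–Vatsal twist exists.** There is
`d ∈ ℚ^×` such that every `ℚ`-model `Wd` of the quadratic twist `E^{(d)}` is MULTIPLICATIVE at `p`
and satisfies the Greenberg–Vatsal parity condition `GVPar Wd p` (some rational `p`-isogeny kernel
ramified-at-`p`-and-even or unramified-at-`p`-and-odd). Proof: `PotMult.exists_twist_mult` gives a
`p`-multiplicative `E^{(d₀)}`; if it fails gvpar, `E^{(d₀(1-p²))}` is still `p`-multiplicative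
(`1 − p²` is a `p`-adic square) and satisfies gvpar by the tree's twist law
`gvPar_of_not_gvPar_of_twist` (`1 − p² < 0`, `p ∤ 1 − p²`: an odd twist unramified at `p` swaps the
two parity types); model independence by `gvPar_of_smul_eq` and
`hasMultiplicativeReductionAtPrime_smul_iff`. So the gvpar clause of
`bsdp_of_classX3M_of_gvPar_rankZero_twist[']` is never the obstruction; only the analytic clause
`L(E^{(D)},1) ≠ 0` on the gvpar sign class is a per-pair datum. [folklore] -/
theorem ClassX3M.exists_mult_gvPar_twist [W.IsGloballyMinimal] (hX : ClassX3M W p) :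
    ∃ d : ℚ, d ≠ 0 ∧ ∀ (Wd : WeierstrassCurve ℚ) [Wd.IsElliptic] (C : VariableChange ℚ),
      C • W.quadraticTwist d = Wd → Mult Wd p ∧ GVPar Wd p := by
  have hp2 : p ≠ 2 := hX.2.2
  obtain ⟨d₀, hd₀, hmult₀⟩ := PotMult.exists_twist_mult (W := W) (p := p) hX.2.1
  haveI hE₀ : (W.quadraticTwist d₀).IsElliptic := W.isElliptic_quadraticTwist hd₀
  have hred₀ : Red (W.quadraticTwist d₀) p :=
    red_of_model_twist (W := W) (p := p) hd₀ ⟨1, one_smul _ _⟩ hX.1.1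
  by_cases hgv : GVPar (W.quadraticTwist d₀) p
  · refine ⟨d₀, hd₀, fun Wd _ C hC => ⟨mult_of_model_twist hd₀ hmult₀ ⟨C, hC⟩, ?_⟩⟩
    haveI : (C • W.quadraticTwist d₀).IsElliptic := by rw [hC]; infer_instance
    exact gvPar_of_smul_eq (W := W.quadraticTwist d₀) Wd C⁻¹ (by rw [← hC, inv_smul_smul]) hgv
  · -- twist once more by `n = 1 - p²`
    set n : ℤ := 1 - (p : ℤ) ^ 2 with hn_def
    have hp1 : (2 : ℤ) ≤ p := by exact_mod_cast (Fact.out : p.Prime).two_le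
    have hn : n < 0 := by nlinarith
    have hpn : ¬ (p : ℤ) ∣ n := by
      intro h
      have h1 : (p : ℤ) ∣ 1 := by
        have : (p : ℤ) ∣ n + (p : ℤ) ^ 2 := dvd_add h (dvd_pow_self _ two_ne_zero)
        simpa [hn_def] using this
      exact (Fact.out : p.Prime).ne_one
        (by exact_mod_cast Int.eq_one_of_dvd_one (Int.natCast_nonneg p) h1)
    have hnQ : ((n : ℤ) : ℚ) ≠ 0 := by exact_mod_cast hn.ne
    have hsq : IsSquare (algebraMap ℚ ℚ_[p] ((n : ℤ) : ℚ)) := isSquare_padic_one_sub_sq hp2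
    -- gvpar for the model `(W^{(d₀)})^{(n)} = W^{(d₀ n)}`
    have hgv' : GVPar ((W.quadraticTwist d₀).quadraticTwist ((n : ℤ) : ℚ)) p :=
      gvPar_of_not_gvPar_of_twist (W := W.quadraticTwist d₀) (p := p) hp2 hred₀ hgv hn hpn
        ((W.quadraticTwist d₀).quadraticTwist ((n : ℤ) : ℚ)) 1 (one_smul _ _)
    rw [quadraticTwist_quadraticTwist] at hgv'
    have hmult' : Mult (W.quadraticTwist (d₀ * ((n : ℤ) : ℚ))) p :=
      mult_quadraticTwist_mul_of_padicSquare hd₀ hnQ hsq hmult₀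
    have hd' : d₀ * ((n : ℤ) : ℚ) ≠ 0 := mul_ne_zero hd₀ hnQ
    haveI : (W.quadraticTwist (d₀ * ((n : ℤ) : ℚ))).IsElliptic := W.isElliptic_quadraticTwist hd'
    refine ⟨d₀ * ((n : ℤ) : ℚ), hd', fun Wd _ C hC => ⟨mult_of_model_twist hd' hmult' ⟨C, hC⟩, ?_⟩⟩
    haveI : (C • W.quadraticTwist (d₀ * ((n : ℤ) : ℚ))).IsElliptic := by rw [hC]; infer_instance
    exact gvPar_of_smul_eq (W := W.quadraticTwist (d₀ * ((n : ℤ) : ℚ))) Wd C⁻¹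
      (by rw [← hC, inv_smul_smul]) hgv'

end Summit.BirchSwinnertonDyer.Rank1Residual.AdditivePotMult

end
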